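import Literature.Analysis.SpecialFunctions.GegenbauerBivariate
import Literature.Geometry.Riemannian.SphericalCylinderEntropy
import Mathlib
import HarnessLib

/-!
# The Gegenbauer polynomials `C_k^{(3/2)}` in `ℝ[X]`: recurrence, derivative identities, the
# ultraspherical ODE, and the typed finite sum (helper for item stmt-SmoothPoincare4-7634,
# `CylinderEntropy.SliceCalibration`)

The route item `SliceCalibration` integrates the zonal heat kernel of `S⁴`,
`𝔥(τ, s) = ∑_k e^{-k(k+3)τ} (2k+3)/3 · C_k^{(3/2)}(s)`, with `C_k^{(3/2)}` typed as the finite sum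
DLMF 18.5.10 (tree: `Literature.Geometry.Riemannian.SphericalCylinderEntropy.gegen`).  This file connects
that finite sum with the tree's bivariate Gegenbauer polynomials
(`Literature.Analysis.SpecialFunctions.gegenbauerHom`, Andrews–Askey–Roy §6.4) specialised to `λ = 3/2`
inside the polynomial ring `ℝ[X]` (`σ = 2X`, `π = 1`, i.e. the polynomial `gegenbauerHom (3/2) k (2X) 1`),
and derives, purely algebraically from the tree's three-term recurrence `gegenbauerHom_rec`:

* `gp_rec` — `(j+2) C_{j+2} = (2j+5) X C_{j+1} - (j+3) C_j`;
* `derivative_gp` — the mixed identity `C_n' = X C_{n+1}' - (n+1) C_{n+1}` (two-step induction), whence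
  `derivative_gp_succ` (`C_{n+1}' = (n+3) C_n + X C_n'`, DLMF §18.9),
  `one_sub_sq_mul_derivative_gp` (`(1-X²) C_{n+1}' = (n+3) C_n - (n+1) X C_{n+1}`) and the
  **ultraspherical differential equation** `gp_ode`: `(1 - X²) C_k'' - 4 X C_k' + k(k+3) C_k = 0`
  (DLMF 18.8, row `C_n^{(λ)}`, with `λ = 3/2`: `C_k^{(3/2)}(⟨x, p⟩)` restricted to `S⁴` is an eigenfunction
  of the Laplacian with eigenvalue `-k(k+3)`);
* `gegen_eq_eval_gp` — the typed finite sum `gegen k s` **is** the evaluation of `C_k^{(3/2)}` at `s`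
  (re-indexing the antidiagonal sum, `(3/2)_{k-l} / (k-l)! · C(k-l, l) = (3/2)_{k-l} / (l! (k-2l)!)`);
* `abs_eval_gp_le` — the crude bound `|C_k^{(3/2)}(s)| ≤ 3^k` on `[-1, 1]` (from the recurrence).

No definition is introduced.

References: G. E. Andrews, R. Askey, R. Roy, *Special Functions*, CUP 1999, §6.4 [AndrewsAskeyRoy1999];
NIST DLMF 18.5.10 (explicit sum), 18.8 (differential equations), 18.9 (recurrences).
-/

noncomputable section

set_option linter.dupNamespace false

open Polynomial Finset
open scoped Nat BigOperators

namespace Summit.SmoothPoincare4.SmoothPoincare4.Theorems.CylinderEntropySliceCalibration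

open Literature.Analysis.SpecialFunctions (gegenbauerHom gegenbauerA gegenbauerHom_rec gegenbauerHom_zero
  gegenbauerHom_one)
open Literature.Geometry.Riemannian.SphericalCylinderEntropy (gegen)

/-! ## The polynomials `C_k^{(3/2)} ∈ ℝ[X]` and their recurrence -/

/-- `C_0^{(3/2)} = 1`. [folklore] -/
theorem gp_zero : (gegenbauerHom (3 / 2 : ℝ) 0 ((2 : ℝ[X]) * X) 1 : ℝ[X]) = 1 :=
  gegenbauerHom_zero _ _ _

/-- `C_1^{(3/2)} = 3X`. [folklore] -/
theorem gp_one : (gegenbauerHom (3 / 2 : ℝ) 1 ((2 : ℝ[X]) * X) 1 : ℝ[X]) = 3 * X := by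
  rw [gegenbauerHom_one, smul_eq_C_mul, ← mul_assoc, ← map_ofNat C 2, ← map_mul, ← map_ofNat C 3]
  norm_num

/-- Natural-number casts `n + c` (`c ≥ 1`) are non-zero in `ℝ[X]`. [folklore] -/
theorem natCast_add_ne_zero (n c : ℕ) (hc : c ≠ 0) : ((n : ℝ[X]) + (c : ℝ[X])) ≠ 0 := by
  have : ((n + c : ℕ) : ℝ[X]) ≠ 0 := Nat.cast_ne_zero.2 (by omega)
  push_cast at this
  exact this

/-- **Three-term recurrence** in `ℝ[X]`: `(j+2) C_{j+2} = (2j+5) X C_{j+1} - (j+3) C_j`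
(AAR (6.4.16) with `λ = 3/2`). [cite: AndrewsAskeyRoy1999, (6.4.16)] -/
theorem gp_rec (j : ℕ) :
    ((j : ℝ[X]) + 2) * gegenbauerHom (3 / 2 : ℝ) (j + 2) ((2 : ℝ[X]) * X) 1 =
      (2 * (j : ℝ[X]) + 5) * X * gegenbauerHom (3 / 2 : ℝ) (j + 1) ((2 : ℝ[X]) * X) 1 -
        ((j : ℝ[X]) + 3) * gegenbauerHom (3 / 2 : ℝ) j ((2 : ℝ[X]) * X) 1 := by
  have h := gegenbauerHom_rec (3 / 2 : ℝ) ((2 : ℝ[X]) * X) 1 j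
  rw [smul_eq_C_mul, smul_eq_C_mul, smul_eq_C_mul] at h
  have h1 : C ((j : ℝ) + 2) = (j : ℝ[X]) + 2 := by
    rw [map_add, map_natCast, map_ofNat]
  have h2 : C ((j : ℝ) + 1 + 3 / 2) * ((2 : ℝ[X]) * X) = (2 * (j : ℝ[X]) + 5) * X := by
    rw [← mul_assoc, ← map_ofNat C 2, ← map_mul]
    have : ((j : ℝ) + 1 + 3 / 2) * 2 = 2 * (j : ℝ) + 5 := by ring
    rw [this, map_add, map_mul, map_natCast, map_ofNat, map_ofNat]
  have h3 : C ((j : ℝ) + 2 * (3 / 2)) = (j : ℝ[X]) + 3 := by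
    have : ((j : ℝ) + 2 * (3 / 2)) = (j : ℝ) + 3 := by ring
    rw [this, map_add, map_natCast, map_ofNat]
  rw [h1, ← mul_assoc, h2, one_mul, h3] at h
  exact h

/-! ## Derivative identities and the ultraspherical ODE -/

/-- **The mixed derivative identity** `C_n' = X C_{n+1}' - (n+1) C_{n+1}` (`λ = 3/2`),
proved by two-step induction from the recurrence alone. [cite: AndrewsAskeyRoy1999, §6.4] -/
theorem derivative_gp (n : ℕ) :
    derivative (gegenbauerHom (3 / 2 : ℝ) n ((2 : ℝ[X]) * X) 1) =
      X * derivative (gegenbauerHom (3 / 2 : ℝ) (n + 1) ((2 : ℝ[X]) * X) 1) -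
        ((n : ℝ[X]) + 1) * gegenbauerHom (3 / 2 : ℝ) (n + 1) ((2 : ℝ[X]) * X) 1 := by
  induction n using Nat.twoStepInduction with
  | zero =>
    rw [gp_zero, zero_add, gp_one]
    simp only [derivative_one, derivative_mul, derivative_ofNat, zero_mul, derivative_X, mul_one,
      zero_add, Nat.cast_zero]
    ring
  | one =>
    have h2 := gp_rec 0
    rw [Nat.cast_zero, zero_add, zero_add, gp_one, gp_zero, mul_one] at h2
    set G2 := gegenbauerHom (3 / 2 : ℝ) 2 ((2 : ℝ[X]) * X) 1 with hG2
    have hd := congrArg derivative h2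
    simp only [derivative_mul, derivative_ofNat, zero_mul, zero_add, derivative_X, mul_one,
      derivative_sub] at hd
    rw [gp_one]
    simp only [derivative_mul, derivative_ofNat, zero_mul, derivative_X, mul_one, zero_add,
      Nat.cast_one, mul_zero, sub_zero] at hd ⊢
    apply mul_left_cancel₀ (two_ne_zero : (2 : ℝ[X]) ≠ 0)
    linear_combination (-X) * hd + (2 : ℝ[X]) * h2
  | more n ih0 ih1 =>
    -- abbreviations
    set G0 := gegenbauerHom (3 / 2 : ℝ) n ((2 : ℝ[X]) * X) 1 with hG0
    set G1 := gegenbauerHom (3 / 2 : ℝ) (n + 1) ((2 : ℝ[X]) * X) 1 with hG1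
    set G2 := gegenbauerHom (3 / 2 : ℝ) (n + 2) ((2 : ℝ[X]) * X) 1 with hG2
    set G3 := gegenbauerHom (3 / 2 : ℝ) (n + 3) ((2 : ℝ[X]) * X) 1 with hG3
    push_cast at ih1 ⊢
    have hR0 := gp_rec n
    rw [← hG0, ← hG1, ← hG2] at hR0
    have hR1 := gp_rec (n + 1)
    rw [← hG1, ← hG2, ← hG3] at hR1
    push_cast at hR1
    have hdR0 := congrArg derivative hR0
    have hdR1 := congrArg derivative hR1
    simp only [derivative_mul, derivative_add, derivative_natCast, derivative_ofNat, zero_mul,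
      zero_add, add_zero, derivative_X, mul_one, derivative_sub, derivative_one, mul_zero] at hdR0 hdR1
    have hn2 : ((n : ℝ[X]) + 2) ≠ 0 := by exact_mod_cast natCast_add_ne_zero n 2 (by norm_num)
    have hn3 : ((n : ℝ[X]) + 3) ≠ 0 := by exact_mod_cast natCast_add_ne_zero n 3 (by norm_num)
    -- (A)_{n+1} : G2' = (n+4) G1 + X G1'
    have hA1 : derivative G2 = ((n : ℝ[X]) + 4) * G1 + X * derivative G1 := by
      apply mul_left_cancel₀ hn2
      linear_combination hdR0 - ((n : ℝ[X]) + 3) * ih0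
    -- (A)_{n+2} : G3' = (n+5) G2 + X G2'
    have hA2 : derivative G3 = ((n : ℝ[X]) + 5) * G2 + X * derivative G2 := by
      apply mul_left_cancel₀ hn3
      linear_combination hdR1 - ((n : ℝ[X]) + 4) * ih1
    apply mul_left_cancel₀ hn3
    linear_combination (-((n : ℝ[X]) + 3) * X) * hA2 + ((n : ℝ[X]) + 3) * hR1 +
      ((n : ℝ[X]) + 3) * hA1 + ((n : ℝ[X]) + 3) * X * ih1


/-- **Forward shift identity** `C_{n+1}' = (n+3) C_n + X C_n'` (`λ = 3/2`, DLMF §18.9). [folklore] -/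
theorem derivative_gp_succ (n : ℕ) :
    derivative (gegenbauerHom (3 / 2 : ℝ) (n + 1) ((2 : ℝ[X]) * X) 1) =
      ((n : ℝ[X]) + 3) * gegenbauerHom (3 / 2 : ℝ) n ((2 : ℝ[X]) * X) 1 +
        X * derivative (gegenbauerHom (3 / 2 : ℝ) n ((2 : ℝ[X]) * X) 1) := by
  cases n with
  | zero =>
    rw [zero_add, gp_one, gp_zero]
    simp only [derivative_mul, derivative_ofNat, zero_mul, derivative_X, mul_one, zero_add,
      Nat.cast_zero, derivative_one, mul_zero, add_zero]
  | succ n =>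
    set G0 := gegenbauerHom (3 / 2 : ℝ) n ((2 : ℝ[X]) * X) 1 with hG0
    set G1 := gegenbauerHom (3 / 2 : ℝ) (n + 1) ((2 : ℝ[X]) * X) 1 with hG1
    set G2 := gegenbauerHom (3 / 2 : ℝ) (n + 2) ((2 : ℝ[X]) * X) 1 with hG2
    have hR0 := gp_rec n
    rw [← hG0, ← hG1, ← hG2] at hR0
    have hdR0 := congrArg derivative hR0
    simp only [derivative_mul, derivative_add, derivative_natCast, derivative_ofNat, zero_mul,
      zero_add, derivative_X, mul_one, derivative_sub] at hdR0
    have ih0 := derivative_gp n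
    rw [← hG0, ← hG1] at ih0
    have hn2 : ((n : ℝ[X]) + 2) ≠ 0 := by exact_mod_cast natCast_add_ne_zero n 2 (by norm_num)
    push_cast
    apply mul_left_cancel₀ hn2
    linear_combination hdR0 - ((n : ℝ[X]) + 3) * ih0

/-- **The first-order identity** `(1 - X²) C_{n+1}' = (n+3) C_n - (n+1) X C_{n+1}` (`λ = 3/2`,
DLMF §18.9). [folklore] -/
theorem one_sub_sq_mul_derivative_gp (n : ℕ) :
    (1 - X ^ 2) * derivative (gegenbauerHom (3 / 2 : ℝ) (n + 1) ((2 : ℝ[X]) * X) 1) =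
      ((n : ℝ[X]) + 3) * gegenbauerHom (3 / 2 : ℝ) n ((2 : ℝ[X]) * X) 1 -
        ((n : ℝ[X]) + 1) * X * gegenbauerHom (3 / 2 : ℝ) (n + 1) ((2 : ℝ[X]) * X) 1 := by
  have hA := derivative_gp_succ n
  have ih := derivative_gp n
  linear_combination hA + X * ih

/-- **The ultraspherical differential equation** for `λ = 3/2`:
`(1 - X²) C_k'' - 4 X C_k' + k(k+3) C_k = 0` (the polynomial `C_k^{(3/2)}` is an eigenfunction of the
radial part of the Laplacian of `S⁴` with eigenvalue `-k(k+3)`; DLMF 18.8). [folklore] -/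
theorem gp_ode (k : ℕ) :
    (1 - X ^ 2) * derivative (derivative (gegenbauerHom (3 / 2 : ℝ) k ((2 : ℝ[X]) * X) 1)) -
        4 * X * derivative (gegenbauerHom (3 / 2 : ℝ) k ((2 : ℝ[X]) * X) 1) +
      (k : ℝ[X]) * ((k : ℝ[X]) + 3) * gegenbauerHom (3 / 2 : ℝ) k ((2 : ℝ[X]) * X) 1 = 0 := by
  cases k with
  | zero =>
    rw [gp_zero]
    simp only [derivative_one, derivative_zero, mul_zero, sub_zero, Nat.cast_zero, zero_mul,
      add_zero]
  | succ n =>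
    set G0 := gegenbauerHom (3 / 2 : ℝ) n ((2 : ℝ[X]) * X) 1 with hG0
    set G1 := gegenbauerHom (3 / 2 : ℝ) (n + 1) ((2 : ℝ[X]) * X) 1 with hG1
    have hD := one_sub_sq_mul_derivative_gp n
    rw [← hG0, ← hG1] at hD
    have ih := derivative_gp n
    rw [← hG0, ← hG1] at ih
    have hdD := congrArg derivative hD
    simp only [derivative_mul, derivative_add, derivative_natCast, derivative_ofNat, zero_mul,
      zero_add, derivative_X, mul_one, derivative_sub, derivative_one, zero_sub, derivative_X_pow,
      map_ofNat, Nat.cast_ofNat] at hdD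
    push_cast
    rw [show (2 : ℕ) - 1 = 1 from rfl, pow_one] at hdD
    linear_combination hdD + ((n : ℝ[X]) + 3) * ih

/-! ## Evaluation: the typed finite sum is `C_k^{(3/2)}` -/

/-- `gegenbauerHom` commutes with `ℝ`-algebra homomorphisms. [folklore] -/
theorem algHom_gegenbauerHom {A B : Type*} [CommRing A] [Algebra ℝ A] [CommRing B] [Algebra ℝ B]
    (f : A →ₐ[ℝ] B) (lam : ℝ) (j : ℕ) (σ π : A) :
    f (gegenbauerHom lam j σ π) = gegenbauerHom lam j (f σ) (f π) := by
  simp only [gegenbauerHom, map_sum, map_smul, map_mul, map_pow, map_neg]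

/-- Evaluation of the polynomial `C_k^{(3/2)} ∈ ℝ[X]` at `s` is the scalar `gegenbauerHom (3/2) k (2s) 1`.
[folklore] -/
theorem eval_gp (k : ℕ) (s : ℝ) :
    (gegenbauerHom (3 / 2 : ℝ) k ((2 : ℝ[X]) * X) 1).eval s = gegenbauerHom (3 / 2 : ℝ) k (2 * s) 1 := by
  have h := algHom_gegenbauerHom (aeval s : ℝ[X] →ₐ[ℝ] ℝ) (3 / 2 : ℝ) k ((2 : ℝ[X]) * X) 1
  rw [coe_aeval_eq_eval] at h
  simp only [eval_mul, eval_ofNat, eval_X, eval_one] at h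
  exact h

/-- The Pochhammer value `(x)_m = ∏_{j<m} (x + j)`. [folklore] -/
theorem ascPochhammer_eval_eq_prod (x : ℝ) (m : ℕ) :
    (ascPochhammer ℝ m).eval x = ∏ j ∈ Finset.range m, (x + (j : ℝ)) := by
  induction m with
  | zero => simp
  | succ m ih => rw [ascPochhammer_succ_eval, ih, Finset.prod_range_succ]

/-- **The typed finite sum is the Gegenbauer polynomial**: the explicit sum DLMF 18.5.10 used in the
route items (`SphericalCylinderEntropy.gegen k s`) is the evaluation at `s` of `C_k^{(3/2)} ∈ ℝ[X]`.
[folklore] -/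
theorem gegen_eq_eval_gp (k : ℕ) (s : ℝ) :
    gegen k s = (gegenbauerHom (3 / 2 : ℝ) k ((2 : ℝ[X]) * X) 1).eval s := by
  rw [eval_gp, gegenbauerHom, Finset.Nat.sum_antidiagonal_eq_sum_range_succ_mk, gegen]
  symm
  refine (Finset.sum_subset (fun l hl => ?_) (fun l hl hl' => ?_)).symm.trans
    (Finset.sum_congr rfl fun l hl => ?_)
  · -- range (k/2+1) ⊆ range (k+1)
    rw [Finset.mem_range] at hl ⊢
    omega
  · -- the extra terms vanish: `C(k-l, l) = 0` for `l > k - l`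
    rw [Finset.mem_range] at hl hl'
    have hlt : k - l < l := by omega
    simp [Nat.choose_eq_zero_of_lt hlt]
  · -- the terms agree for `2l ≤ k`
    rw [Finset.mem_range] at hl
    have hle : l ≤ k - l := by omega
    have hkl : k - l - l = k - 2 * l := by omega
    rw [smul_eq_mul, gegenbauerA, ascPochhammer_eval_eq_prod, Nat.cast_choose ℝ hle, hkl]
    have hf : ((k - l)! : ℝ) ≠ 0 := by exact_mod_cast Nat.factorial_ne_zero _
    field_simp

/-! ## A crude bound on `[-1, 1]` -/

/-- The evaluated recurrence `(j+2) C_{j+2}(s) = (2j+5) s C_{j+1}(s) - (j+3) C_j(s)`. [folklore] -/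
theorem eval_gp_rec (j : ℕ) (s : ℝ) :
    ((j : ℝ) + 2) * (gegenbauerHom (3 / 2 : ℝ) (j + 2) ((2 : ℝ[X]) * X) 1).eval s =
      (2 * (j : ℝ) + 5) * s * (gegenbauerHom (3 / 2 : ℝ) (j + 1) ((2 : ℝ[X]) * X) 1).eval s -
        ((j : ℝ) + 3) * (gegenbauerHom (3 / 2 : ℝ) j ((2 : ℝ[X]) * X) 1).eval s := by
  have h := congrArg (eval s) (gp_rec j)
  simp only [eval_mul, eval_sub, eval_add, eval_natCast, eval_ofNat, eval_X] at h
  exact h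

/-- **Crude bound**: `|C_k^{(3/2)}(s)| ≤ 3^k` for `|s| ≤ 1` (from the recurrence; the sharp bound is
`C_k^{(3/2)}(1) = (k+1)(k+2)/2`). [folklore] -/
theorem abs_eval_gp_le (k : ℕ) {s : ℝ} (hs : |s| ≤ 1) :
    |(gegenbauerHom (3 / 2 : ℝ) k ((2 : ℝ[X]) * X) 1).eval s| ≤ 3 ^ k := by
  induction k using Nat.twoStepInduction with
  | zero => rw [gp_zero]; simp
  | one =>
    rw [gp_one]
    simp only [eval_mul, eval_ofNat, eval_X, pow_one, abs_mul, Nat.abs_ofNat]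
    linarith
  | more j ih0 ih1 =>
    have h := eval_gp_rec j s
    set a := (gegenbauerHom (3 / 2 : ℝ) j ((2 : ℝ[X]) * X) 1).eval s
    set b := (gegenbauerHom (3 / 2 : ℝ) (j + 1) ((2 : ℝ[X]) * X) 1).eval s
    set c := (gegenbauerHom (3 / 2 : ℝ) (j + 2) ((2 : ℝ[X]) * X) 1).eval s
    have hj : (0 : ℝ) < (j : ℝ) + 2 := by positivity
    have h3 : (0 : ℝ) ≤ 3 ^ j := by positivity
    have hsb : |s * b| ≤ 3 ^ (j + 1) := by
      rw [abs_mul]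
      calc |s| * |b| ≤ 1 * 3 ^ (j + 1) := mul_le_mul hs ih1 (abs_nonneg _) zero_le_one
        _ = 3 ^ (j + 1) := one_mul _
    have key : ((j : ℝ) + 2) * |c| ≤ ((j : ℝ) + 2) * 3 ^ (j + 2) := by
      have e : ((j : ℝ) + 2) * c = (2 * (j : ℝ) + 5) * (s * b) - ((j : ℝ) + 3) * a := by
        rw [h]; ring
      calc ((j : ℝ) + 2) * |c| = |((j : ℝ) + 2) * c| := by
            rw [abs_mul, abs_of_pos hj]
        _ = |(2 * (j : ℝ) + 5) * (s * b) - ((j : ℝ) + 3) * a| := by rw [e]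
        _ ≤ |(2 * (j : ℝ) + 5) * (s * b)| + |((j : ℝ) + 3) * a| := abs_sub _ _
        _ = (2 * (j : ℝ) + 5) * |s * b| + ((j : ℝ) + 3) * |a| := by
            rw [abs_mul (2 * (j : ℝ) + 5), abs_mul ((j : ℝ) + 3),
              abs_of_pos (by positivity : (0 : ℝ) < 2 * (j : ℝ) + 5),
              abs_of_pos (by positivity : (0 : ℝ) < (j : ℝ) + 3)]
        _ ≤ (2 * (j : ℝ) + 5) * 3 ^ (j + 1) + ((j : ℝ) + 3) * 3 ^ j := by
            gcongr
        _ = (7 * (j : ℝ) + 18) * 3 ^ j := by ring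
        _ ≤ ((j : ℝ) + 2) * 3 ^ (j + 2) := by
            rw [pow_succ, pow_succ]
            nlinarith
    exact le_of_mul_le_mul_left key hj

/-- The evaluated ODE: `(1 - x²) C_k''(x) - 4x C_k'(x) = -k(k+3) C_k(x)`. [folklore] -/
theorem eval_gp_ode (k : ℕ) (x : ℝ) :
    (1 - x ^ 2) * (derivative (derivative (gegenbauerHom (3 / 2 : ℝ) k ((2 : ℝ[X]) * X) 1))).eval x -
        4 * x * (derivative (gegenbauerHom (3 / 2 : ℝ) k ((2 : ℝ[X]) * X) 1)).eval x =
      -((k : ℝ) * ((k : ℝ) + 3)) * (gegenbauerHom (3 / 2 : ℝ) k ((2 : ℝ[X]) * X) 1).eval x := by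
  have h := congrArg (eval x) (gp_ode k)
  simp only [eval_add, eval_sub, eval_mul, eval_one, eval_pow, eval_X, eval_ofNat, eval_natCast,
    eval_zero] at h
  linear_combination h

end Summit.SmoothPoincare4.SmoothPoincare4.Theorems.CylinderEntropySliceCalibration
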